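/-
Copyright (c) 2026 the pub-hodgecm-mathlib formalisation cell (harness21).  Prover seat hodgecm-mathlib-F0P3b-p01 (g13): «S3-ram» seeding wave (LEAD F0P3a-plan (g12)
T11-41; owner F0P3a-p06 (g15)), row «P-1-ram (i) (N1)», sequel «FOUR-CLASSES ASSEMBLY (place-generic)»; 2026-09-01.
-/
import Literature.NumberTheory.Rogawski1990.UnitFundamentalLemmaInertSplitClauseOfValues    -- ★ p04 (g12) (F12): `mk_mem_conjClassesIn_of_isLocalNormPair`; brings ★ `ncard_conjClassesIn_eq_four`, ★ `mk_mem_conjClassesIn_of_finExplicitDelta_ne_zero`, ★ `finKappaAt_out_mk`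
import Literature.NumberTheory.Rogawski1990.UnitFundamentalLemmaRamifiedFlickerRepresentatives  -- ★ p846967 (this seat): the four ramified representatives (one-place currency, ★ p846897 frame)
import Literature.NumberTheory.Automorphic.LocalGLCongruenceBoxIwahori                         -- ★ `localGLPiEquiv_apply_apply`
import HarnessLib

/-!
# The `G′`-side of a type-(1) clause from four matched, pairwise non-conjugate representatives — PLACE-GENERIC (non-split `v`, ramified allowed), `κ` symbolic:
# `∑ᶠ c, Δ‴_v(γ_H, out c)·Φ(c, f) = τ_v(γ_H)·D_v(γ_H)·∑_b κ_v(γ_H, t_b)·Φ(⟦t_b⟧, f)` (Rogawski 1990 (4.3.1)–(4.3.2), Prop. 3.5.2 (c); Flicker 1998 §6)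

Topic `NumberTheory/Rogawski1990`; namespace `Literature.NumberTheory.Rogawski1990`.  THEOREMS ONLY (no definition, no named fact, no instance, no notation, no `sorry`).
Cell `pub/hodgecm-mathlib`, crux H413 (`--supports stmt-HodgeConjecture-24833`), «S3-ram» seeding wave (LEAD T11-41, owner F0P3a-p06 (g15)), row «P-1-ram (i) (N1)» sequel:
the ASSEMBLY that turns ★ `exists_four_ramified_representatives` (four `t b₀ b₁`, matched, pairwise non-conjugate) + ★ `finKappaAt_ramified_representative_eq` (their signs)
+ the strata counts (ii) into STUB A′ of A-p16 (g31)'s «P-1-ram» skeleton.  It is the ramified-ready twin of ★ (F12)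
`finsum_delta_mul_classOrbitalIntegral_eq_of_four_classes_of_values`, whose only inert inputs (`hunr`, `hμ` — used to EVALUATE `τ_v·D_v` as `(−q)^{−m}`) are
removed by keeping the common factor SYMBOLIC: by DEFINITION (★ `finExplicitDelta_of_isLocalNormPair`) `Δ‴_v(γ_H, γ′) = τ_v(γ_H, μ)·D_v(γ_H)·κ_v(γ_H, γ′)` on matched
pairs at EVERY place, so the four-class sum factors through `τ_v·D_v` whatever its value (at a tame-ramified `w` it is read by ★ p846868 ∕ ★ p846910, conductor-one `μ_w`).
HONEST LABEL: HC_CM is proved only modulo the 2 remaining named inputs (hLiu418 24832, h413 24833) until rung 0 closes; this file is bookkeeping, no books consequence.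

**Contents.**
* §1 `exists_localRing_frame_of_onePlace_frame` — ONE-PLACE ⇒ SEMILOCAL eigenframes at a non-split `v`: from `t_w · Q = Q · diag(x)` in `GL₃(L_w)` a frame
  `t · P = P · diag(u)` in `GL₃(E_v)`, `E_v = ∏_{w′∣v} L_{w′}`, with `u_i(w) = x_i`, `P_{ij}(w) = Q_{ij}`, `u` injective and `σ`-norm-one when `x` is (the bridge from the
  currency of ★ p846967 ∕ ★ p846897 to the semilocal currency of ★ `ncard_conjClassesIn_eq_four` and ★ `finKappaAt_eq_ite_twistGram_eigenframe`).
* §3 (adapter) `exists_onePlace_endoGL_frame`, `injective_and_norm_one_onePlace_of_localRing` — from a semilocal eigenframe `g·P₂ = P₂·diag(u)` of `γ_H.1` the ONE-PLACE X-frame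
  `ι((γ_H)_w)·Q = Q·diag(u₀(w), u(w), u₁(w))` with `x 1 = finGammaTwo … w` by `rfl`, `x` injective and norm-one (the inputs of ★ p846967's «matching» and ★ p846987's `hj`).
* §2 **`finsum_delta_mul_classOrbitalIntegral_eq_mul_sum_kappa_of_four_representatives`** — for `t : Fin 2 → Fin 2 → G′_v` matched with the `G`-regular `γ_H`, pairwise
  non-conjugate, `t 0 0` with a type-(1) semilocal eigenframe: `∑ᶠ c, Δ‴_v(γ_H, out c)·Φ(c, f) = τ_v(γ_H, μ)·D_v(γ_H)·∑_{b₀,b₁} κ_v(γ_H, t_b)·Φ(⟦t_b⟧, f)` for ANY `f` and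
  ANY orbital-measure family; and `…_of_onePlace_frame`, the same with the frame hypothesis in one-place currency (§1).

## References
* [Rogawski1990] J. D. Rogawski, *Automorphic Representations of Unitary Groups in Three Variables*, Ann. of Math. Stud. 123 (1990), §3.5 Prop. 3.5.2 (c) p. 29, §4.3
  (4.3.1)–(4.3.2) p. 43, §4.9 Prop. 4.9.1 p. 55.
* [Flicker1998UnitaryFL] Y. Z. Flicker, *Elementary proof of the fundamental lemma for a unitary group*, Canad. J. Math. 50 (1998), Prop. 3 p. 78, §6 p. 95.
* [Kottwitz1986] R. E. Kottwitz, *Stable trace formula: elliptic singular terms*, Math. Ann. 275 (1986), §7.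
-/

set_option autoImplicit false

noncomputable section

open NumberField IsDedekindDomain Matrix
open scoped MatrixGroups

namespace Literature.NumberTheory.Rogawski1990

open Literature.NumberTheory.Automorphic Literature.NumberTheory.Automorphic.UnitaryGroup
open Literature.NumberTheory.GaloisRepresentations Literature.NumberTheory.NumberFields Literature.NumberTheory.QuadraticForms
open Literature.AlgebraicGeometry.ShimuraVarieties (unitaryGroup mem_unitaryGroup_iff)

section Assembly

variable (L : Type) [Field L] [NumberField L] [IsCMField L] (v : HeightOneSpectrum (𝓞 ↥(maximalRealSubfield L)))
  (H' : Matrix (Fin 3) (Fin 3) L)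
  (a : (UnitaryGroup.cmDatum L 2 (Matrix.of fun i j : Fin 2 => if i.val + j.val + 1 = 2 then (1 : L) else 0)).Local v ×
      (UnitaryGroup.cmDatum L 1 (Matrix.of fun i j : Fin 1 => if i.val + j.val + 1 = 1 then (1 : L) else 0)).Local v)
  (w : UnitaryGroup.PlacesOver L v) (hw : IsCMField.complexConj L • w.1 = w.1)

/-! ## §1 One-place eigenframes are semilocal eigenframes at a non-split place -/

include hw in
/-- **ONE-PLACE ⇒ SEMILOCAL EIGENFRAME.**  At a non-split `v` (one place `w`; `E_v = ∏_{w′ ∣ v} L_{w′} ≅ L_w`), an eigenframe `t_w · Q = Q · diag(x)` of the `w`-component of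
`t ∈ G′_v` in `GL₃(L_w)` lifts to a semilocal eigenframe `t · P = P · diag(u)` in `GL₃(E_v)` with `u_i(w) = x_i`, `P_{ij}(w) = Q_{ij}`; `u` is injective, resp. has
`σ`-norm-one entries, when `x` does. [cite: Rogawski1990, §3.5 p. 29; §4.9 p. 54] [cite: PlatonovRapinchuk1994, §5.1] -/
theorem exists_localRing_frame_of_onePlace_frame (t : (UnitaryGroup.cmDatum L 3 H').Local v)
    {Q : GL (Fin 3) (w.1.adicCompletion L)} {x : Fin 3 → w.1.adicCompletion L}
    (hQ : (((localNonsplitEquiv (IsCMField.complexConj L) H' (IsCMField.complexConj_ne_one L) w hw t).val :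
        GL (Fin 3) (w.1.adicCompletion L)) : Matrix (Fin 3) (Fin 3) (w.1.adicCompletion L)) * Q.val = Q.val * diagonal x)
    (hx : Function.Injective x) (hx1 : ∀ i, galAdicCompletionMap (L := L) (IsCMField.complexConj L) hw (x i) * x i = 1) :
    ∃ (P : GL (Fin 3) (UnitaryGroup.LocalRing L v)) (u : Fin 3 → UnitaryGroup.LocalRing L v),
      (t.val.val : Matrix (Fin 3) (Fin 3) (UnitaryGroup.LocalRing L v)) * P.val = P.val * diagonal u ∧
      (∀ i, u i w = x i) ∧ (∀ i j, (P.val : Matrix (Fin 3) (Fin 3) (UnitaryGroup.LocalRing L v)) i j w = Q.val i j) ∧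
      Function.Injective u ∧ (∀ i, UnitaryGroup.conjLocal L (IsCMField.complexConj L) v (u i) * u i = 1) := by
  have hc := IsCMField.complexConj_ne_one L
  haveI : Algebra.IsQuadraticExtension ↥(maximalRealSubfield L) L := IsCMField.isQuadraticExtension L
  have hvs : Subsingleton (PlacesOver L v) := PlacesOver.subsingleton_of_smul_eq (IsCMField.complexConj L) hc w hw
  letI : Unique (PlacesOver L v) := @uniqueOfSubsingleton _ hvs w
  -- the lifts
  set P : GL (Fin 3) (UnitaryGroup.LocalRing L v) := (localGLPiEquiv L 3 v).symm ((localGLPiEvalEquiv (IsCMField.complexConj L) 3 hc w hw).symm Q) with hPdef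
  set u : Fin 3 → UnitaryGroup.LocalRing L v := fun i => (RingEquiv.piUnique fun w' : PlacesOver L v => w'.1.adicCompletion L).symm (x i) with hudef
  have huw : ∀ i, u i w = x i := fun i => (RingEquiv.piUnique fun w' : PlacesOver L v => w'.1.adicCompletion L).apply_symm_apply _
  have hPw : ∀ i j, (P.val : Matrix (Fin 3) (Fin 3) (UnitaryGroup.LocalRing L v)) i j w = Q.val i j := by
    intro i j
    rw [← localGLPiEquiv_apply_apply, hPdef, (localGLPiEquiv L 3 v).apply_symm_apply, localGLPiEvalEquiv_symm_apply_self]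
  have htw : ∀ i k, (t.val.val : Matrix (Fin 3) (Fin 3) (UnitaryGroup.LocalRing L v)) i k w =
      (((localNonsplitEquiv (IsCMField.complexConj L) H' hc w hw t).val : GL (Fin 3) (w.1.adicCompletion L)) :
        Matrix (Fin 3) (Fin 3) (w.1.adicCompletion L)) i k := fun i k => by
    have h := congr_fun (congr_fun (coe_localNonsplitEquiv_apply L H' v w hw t) i) k
    rw [h, Matrix.map_apply]; rfl
  refine ⟨P, u, ?_, huw, hPw, fun i j hij => hx ?_, fun i => ?_⟩
  · refine Matrix.ext fun i j => ?_
    rw [LocalRing.eq_iff_apply_eq (IsCMField.complexConj L) hc w hw]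
    have h := congr_fun (congr_fun hQ i) j
    rw [Matrix.mul_apply, Matrix.mul_diagonal] at h
    rw [Matrix.mul_diagonal, Pi.mul_apply, hPw, huw, Matrix.mul_apply, Finset.sum_apply]
    simp only [Pi.mul_apply, htw, hPw]
    exact h
  · rw [← huw i, ← huw j, hij]
  · rw [LocalRing.eq_iff_apply_eq (IsCMField.complexConj L) hc w hw, Pi.mul_apply, conjLocal_apply_eq_galAdicCompletionMap L v w hw, huw, Pi.one_apply]
    exact hx1 i

/-! ## §2 The four-classes assembly with symbolic `κ` and symbolic common factor `τ_v · D_v` -/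

/-- A CM field has a non-zero element negated by complex conjugation (the `δ` of the generic class count). [cite: Rogawski1990, §1.10] -/
private theorem exists_complexConj_eq_neg_ne_zero₄ (L : Type) [Field L] [NumberField L] [IsCMField L] :
    ∃ δ : L, IsCMField.complexConj L δ = -δ ∧ δ ≠ 0 := by
  obtain ⟨ζ, hζ⟩ := not_forall.1 fun h0 => IsCMField.complexConj_ne_one L (AlgEquiv.ext h0)
  refine ⟨ζ - IsCMField.complexConj L ζ, by rw [map_sub, IsCMField.complexConj_apply_apply, neg_sub], fun h0 => hζ ?_⟩
  rw [sub_eq_zero] at h0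
  exact h0.symm

include hw in
open scoped Classical in
/-- **THE `G′`-SIDE OF A TYPE-(1) CLAUSE FROM FOUR MATCHED, PAIRWISE NON-CONJUGATE REPRESENTATIVES — place-generic, `κ` symbolic.**  `v` non-split (`c • w = w`;
ramified allowed), `γ_H = a`, `t : Fin 2 → Fin 2 → G′_v` matched with `ι_v(γ_H)` and pairwise non-conjugate, `t 0 0` with a type-(1) eigenframe
`t₀₀ · P = P · diag(u′)` (`u′` injective, norm-one — used only to COUNT the stable class: four classes, ★ `ncard_conjClassesIn_eq_four`).  Then the classes `⟦t_b⟧` ARE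
the matched classes, and since `Δ‴_v(γ_H, ·) = τ_v(γ_H, μ) · D_v(γ_H) · κ_v(γ_H, ·)` on them (★ `finExplicitDelta_of_isLocalNormPair`), for ANY `f` and ANY orbital-measure family
`∑ᶠ c, Δ‴_v(γ_H, out c)·Φ(c, f) = τ_v(γ_H, μ)·D_v(γ_H) · ∑_{b₀ b₁} κ_v(γ_H, t_b)·Φ(⟦t_b⟧, f)`.  At an inert `w` with unramified `μ` the factor is `(−q_v)^{−ord_w χ_g(u)}`
(★ (F12)); at a tame-ramified `w` it is read by ★ p846868 ∕ ★ p846910; the representatives are ★ `exists_four_ramified_representatives` and their signs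
★ `finKappaAt_ramified_representative_eq`. [cite: Rogawski1990, §4.3 (4.3.1)–(4.3.2) p. 43; §4.9 Prop. 4.9.1 p. 55; §3.5 Prop. 3.5.2 (c) p. 29] [cite: Flicker1998UnitaryFL, §6 p. 95] -/
theorem finsum_delta_mul_classOrbitalIntegral_eq_mul_sum_kappa_of_four_representatives
    [∀ γ : (UnitaryGroup.cmDatum L 3 H').Local v,
    MeasurableSpace (((UnitaryGroup.cmDatum L 3 H').Local v) ⧸ Subgroup.centralizer ({γ} : Set ((UnitaryGroup.cmDatum L 3 H').Local v)))]
    (μ : HeckeCharacter L)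
    (hl : ∀ (v : HeightOneSpectrum (𝓞 ↥(maximalRealSubfield L)))
      (a : (UnitaryGroup.cmDatum L 2 (Matrix.of fun i j : Fin 2 => if i.val + j.val + 1 = 2 then (1 : L) else 0)).Local v ×
      (UnitaryGroup.cmDatum L 1 (Matrix.of fun i j : Fin 1 => if i.val + j.val + 1 = 1 then (1 : L) else 0)).Local v)
      (b : (UnitaryGroup.cmDatum L 3 H').Local v)
      (x : (UnitaryGroup.cmDatum L 2 (Matrix.of fun i j : Fin 2 => if i.val + j.val + 1 = 2 then (1 : L) else 0)).Local v ×
      (UnitaryGroup.cmDatum L 1 (Matrix.of fun i j : Fin 1 => if i.val + j.val + 1 = 1 then (1 : L) else 0)).Local v),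
      finExplicitDelta L v H' (x * a * x⁻¹) μ b = finExplicitDelta L v H' a μ b)
    (hr : ∀ (v : HeightOneSpectrum (𝓞 ↥(maximalRealSubfield L)))
      (a : (UnitaryGroup.cmDatum L 2 (Matrix.of fun i j : Fin 2 => if i.val + j.val + 1 = 2 then (1 : L) else 0)).Local v ×
      (UnitaryGroup.cmDatum L 1 (Matrix.of fun i j : Fin 1 => if i.val + j.val + 1 = 1 then (1 : L) else 0)).Local v)
      (b y : (UnitaryGroup.cmDatum L 3 H').Local v),
      finExplicitDelta L v H' a μ (y * b * y⁻¹) = finExplicitDelta L v H' a μ b)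
    {t : Fin 2 → Fin 2 → (UnitaryGroup.cmDatum L 3 H').Local v}
    (hmatch : ∀ b₀ b₁, IsLocalNormPair L H' v a (t b₀ b₁))
    (hinj : ∀ b₀ b₁ b₀' b₁', IsConj (t b₀ b₁) (t b₀' b₁') → b₀ = b₀' ∧ b₁ = b₁')
    (hH : (((UnitaryGroup.adelicForm L 3 H').map (UnitaryGroup.adeleToLocal L v)).map
      (UnitaryGroup.conjLocal L (IsCMField.complexConj L) v))ᵀ = (UnitaryGroup.adelicForm L 3 H').map (UnitaryGroup.adeleToLocal L v))
    (hHd : IsUnit ((UnitaryGroup.adelicForm L 3 H').map (UnitaryGroup.adeleToLocal L v)).det)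
    {P : GL (Fin 3) (UnitaryGroup.LocalRing L v)} {u' : Fin 3 → UnitaryGroup.LocalRing L v}
    (hP : ((t 0 0).val.val : Matrix (Fin 3) (Fin 3) (UnitaryGroup.LocalRing L v)) * P.val = P.val * diagonal u')
    (hu' : Function.Injective u') (hu'1 : ∀ i, UnitaryGroup.conjLocal L (IsCMField.complexConj L) v (u' i) * u' i = 1)
    (mG : OrbitalMeasureFamily ((UnitaryGroup.cmDatum L 3 H').Local v)) (f : (UnitaryGroup.cmDatum L 3 H').Local v → ℂ) :
    ∑ᶠ c : ConjClasses ((UnitaryGroup.cmDatum L 3 H').Local v),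
        (finExplicitCollection L H' μ hl hr v).Δ a (Quotient.out c) * classOrbitalIntegral mG f c =
      finTau L v a μ * (finWeylRatio L v a : ℂ) *
        ∑ b₀ : Fin 2, ∑ b₁ : Fin 2, ((finKappaAt L v H' a (t b₀ b₁) : ℤ) : ℂ) * classOrbitalIntegral mG f (ConjClasses.mk (t b₀ b₁)) := by
  set F : ConjClasses ((UnitaryGroup.cmDatum L 3 H').Local v) → ℂ :=
    fun c => (finExplicitCollection L H' μ hl hr v).Δ a (Quotient.out c) * classOrbitalIntegral mG f c with hF
  set g : Fin 2 × Fin 2 → ConjClasses ((UnitaryGroup.cmDatum L 3 H').Local v) := fun b => ConjClasses.mk (t b.1 b.2) with hg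
  have hginj : Function.Injective g := by
    rintro ⟨b₀, b₁⟩ ⟨b₀', b₁'⟩ h
    obtain ⟨h0, h1⟩ := hinj b₀ b₁ b₀' b₁' (ConjClasses.mk_eq_mk_iff_isConj.1 h)
    rw [h0, h1]
  -- the stable class of `t 0 0`: four classes, finite
  obtain ⟨δ₁, hcδ, hδ⟩ := exists_complexConj_eq_neg_ne_zero₄ L
  have hS4 := ncard_conjClassesIn_eq_four L v (IsCMField.complexConj L) hcδ hδ w hw hH hHd (t 0 0).2 hP hu' hu'1
  have hSfin := finite_conjClassesIn_of_eigenframe L v (IsCMField.complexConj L) hcδ hδ w hw hH hHd (t 0 0).2 hP hu' hu'1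
  have hmk : ∀ c : ConjClasses ((UnitaryGroup.cmDatum L 3 H').Local v),
      ConjClasses.mk (⟨(Quotient.out c).val, (Quotient.out c).2⟩ : unitaryGroup (UnitaryGroup.conjLocal L (IsCMField.complexConj L) v)
        ((UnitaryGroup.adelicForm L 3 H').map (UnitaryGroup.adeleToLocal L v))) = c := fun c => Quotient.out_eq c
  -- the four classes lie in the stable class of `t 0 0` and are four: they ARE the stable class
  have hsub : Set.range g ⊆ conjClassesIn (UnitaryGroup.conjLocal L (IsCMField.complexConj L) v)
      ((UnitaryGroup.adelicForm L 3 H').map (UnitaryGroup.adeleToLocal L v)) ⟨(t 0 0).val, (t 0 0).2⟩ := by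
    rintro c ⟨⟨b₀, b₁⟩, rfl⟩
    exact mk_mem_conjClassesIn_of_isLocalNormPair L v H' a (hmatch 0 0) (hmatch b₀ b₁)
  have h4 : (Set.range g).ncard = 4 := by
    rw [Set.ncard_range_of_injective hginj, Nat.card_prod, Nat.card_eq_fintype_card, Fintype.card_fin]
  have heq := Set.eq_of_subset_of_ncard_le hsub (Nat.le_of_eq (hS4.trans h4.symm)) hSfin
  -- support inside the four
  have hsupp : Function.support F ⊆ Set.range g := by
    intro c hc
    rw [Function.mem_support] at hc
    have hΔ : finExplicitDelta L v H' a μ (Quotient.out c) ≠ 0 := by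
      intro h0
      apply hc
      simp only [hF, finExplicitCollection_Δ, h0, zero_mul]
    have hmem := mk_mem_conjClassesIn_of_finExplicitDelta_ne_zero L v H' a (t 0 0) μ (hmatch 0 0) hΔ
    rwa [hmk, ← heq] at hmem
  rw [← finsum_mem_univ, finsum_mem_inter_support_eq' F Set.univ (Set.range g) (fun x hx => ⟨fun _ => hsupp hx, fun _ => Set.mem_univ _⟩),
    finsum_mem_range hginj, finsum_eq_sum_of_fintype, Fintype.sum_prod_type, Finset.mul_sum]
  refine Finset.sum_congr rfl fun b₀ _ => ?_
  rw [Finset.mul_sum]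
  refine Finset.sum_congr rfl fun b₁ _ => ?_
  -- the chosen representative of `⟦t⟧` is matched, with the same `κ`
  have hout : IsLocalNormPair L H' v a (Quotient.out (ConjClasses.mk (t b₀ b₁))) := by
    obtain ⟨c, hc⟩ := isConj_iff.1 (ConjClasses.mk_eq_mk_iff_isConj.1 (Quotient.out_eq (ConjClasses.mk (t b₀ b₁))).symm)
    rw [← hc]
    exact (isLocalNormPair_conj_right L v H' a (t b₀ b₁) (c : (UnitaryGroup.cmDatum L 3 H').Local v)).2 (hmatch b₀ b₁)
  simp only [hF, hg, finExplicitCollection_Δ]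
  rw [finExplicitDelta_of_isLocalNormPair L v H' a μ hout, finKappaAt_out_mk L v H' a (t b₀ b₁) (hmatch b₀ b₁)]
  ring

include hw in
open scoped Classical in
/-- **The same, with the frame of `t 0 0` in ONE-PLACE currency** (`t₀₀,w · Q = Q · diag(x)` in `GL₃(L_w)`, as exported by ★ `exists_four_ramified_representatives` via
★ `onePlace_frame_of_conj_frame`; bridged by §1). [cite: Rogawski1990, §4.3 (4.3.1)–(4.3.2) p. 43; §4.9 Prop. 4.9.1 p. 55] -/
theorem finsum_delta_mul_classOrbitalIntegral_eq_mul_sum_kappa_of_four_representatives_of_onePlace_frame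
    [∀ γ : (UnitaryGroup.cmDatum L 3 H').Local v,
    MeasurableSpace (((UnitaryGroup.cmDatum L 3 H').Local v) ⧸ Subgroup.centralizer ({γ} : Set ((UnitaryGroup.cmDatum L 3 H').Local v)))]
    (μ : HeckeCharacter L)
    (hl : ∀ (v : HeightOneSpectrum (𝓞 ↥(maximalRealSubfield L)))
      (a : (UnitaryGroup.cmDatum L 2 (Matrix.of fun i j : Fin 2 => if i.val + j.val + 1 = 2 then (1 : L) else 0)).Local v ×
      (UnitaryGroup.cmDatum L 1 (Matrix.of fun i j : Fin 1 => if i.val + j.val + 1 = 1 then (1 : L) else 0)).Local v)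
      (b : (UnitaryGroup.cmDatum L 3 H').Local v)
      (x : (UnitaryGroup.cmDatum L 2 (Matrix.of fun i j : Fin 2 => if i.val + j.val + 1 = 2 then (1 : L) else 0)).Local v ×
      (UnitaryGroup.cmDatum L 1 (Matrix.of fun i j : Fin 1 => if i.val + j.val + 1 = 1 then (1 : L) else 0)).Local v),
      finExplicitDelta L v H' (x * a * x⁻¹) μ b = finExplicitDelta L v H' a μ b)
    (hr : ∀ (v : HeightOneSpectrum (𝓞 ↥(maximalRealSubfield L)))
      (a : (UnitaryGroup.cmDatum L 2 (Matrix.of fun i j : Fin 2 => if i.val + j.val + 1 = 2 then (1 : L) else 0)).Local v ×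
      (UnitaryGroup.cmDatum L 1 (Matrix.of fun i j : Fin 1 => if i.val + j.val + 1 = 1 then (1 : L) else 0)).Local v)
      (b y : (UnitaryGroup.cmDatum L 3 H').Local v),
      finExplicitDelta L v H' a μ (y * b * y⁻¹) = finExplicitDelta L v H' a μ b)
    {t : Fin 2 → Fin 2 → (UnitaryGroup.cmDatum L 3 H').Local v}
    (hmatch : ∀ b₀ b₁, IsLocalNormPair L H' v a (t b₀ b₁))
    (hinj : ∀ b₀ b₁ b₀' b₁', IsConj (t b₀ b₁) (t b₀' b₁') → b₀ = b₀' ∧ b₁ = b₁')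
    (hH : (((UnitaryGroup.adelicForm L 3 H').map (UnitaryGroup.adeleToLocal L v)).map
      (UnitaryGroup.conjLocal L (IsCMField.complexConj L) v))ᵀ = (UnitaryGroup.adelicForm L 3 H').map (UnitaryGroup.adeleToLocal L v))
    (hHd : IsUnit ((UnitaryGroup.adelicForm L 3 H').map (UnitaryGroup.adeleToLocal L v)).det)
    {Q : GL (Fin 3) (w.1.adicCompletion L)} {x : Fin 3 → w.1.adicCompletion L}
    (hQ : (((localNonsplitEquiv (IsCMField.complexConj L) H' (IsCMField.complexConj_ne_one L) w hw (t 0 0)).val :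
        GL (Fin 3) (w.1.adicCompletion L)) : Matrix (Fin 3) (Fin 3) (w.1.adicCompletion L)) * Q.val = Q.val * diagonal x)
    (hx : Function.Injective x) (hx1 : ∀ i, galAdicCompletionMap (L := L) (IsCMField.complexConj L) hw (x i) * x i = 1)
    (mG : OrbitalMeasureFamily ((UnitaryGroup.cmDatum L 3 H').Local v)) (f : (UnitaryGroup.cmDatum L 3 H').Local v → ℂ) :
    ∑ᶠ c : ConjClasses ((UnitaryGroup.cmDatum L 3 H').Local v),
        (finExplicitCollection L H' μ hl hr v).Δ a (Quotient.out c) * classOrbitalIntegral mG f c =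
      finTau L v a μ * (finWeylRatio L v a : ℂ) *
        ∑ b₀ : Fin 2, ∑ b₁ : Fin 2, ((finKappaAt L v H' a (t b₀ b₁) : ℤ) : ℂ) * classOrbitalIntegral mG f (ConjClasses.mk (t b₀ b₁)) := by
  obtain ⟨P, u, hP, -, -, hu', hu'1⟩ := exists_localRing_frame_of_onePlace_frame L v H' w hw (t 0 0) hQ hx hx1
  exact finsum_delta_mul_classOrbitalIntegral_eq_mul_sum_kappa_of_four_representatives L v H' a w hw μ hl hr hmatch hinj hH hHd hP hu' hu'1 mG f

/-! ## §3 The adapter: the one-place eigenframe of `ι((γ_H)_w)` from a semilocal eigenframe of the `U(Φ₂)`-part -/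

include hw in
/-- **ONE-PLACE EIGENFRAME OF `endoGL((γ_H.1)_w, (γ_H.2)_w)` FROM A SEMILOCAL EIGENFRAME OF `g = γ_H.1`.**  If `g · P₂ = P₂ · diag(u)` in `GL₂(E_v)` then, at the unique
place `w`, `ι((γ_H)_w) · Q = Q · diag(u₀(w), u(w), u₁(w))` with `Q := endoGL((P₂)_w, 1)` and `u(w) = finGammaTwo γ_H (w)` the `U(Φ₁)`-entry — slot order `(α, u, γ) = (0,1,2)`,
the X-frame that ★ `exists_four_ramified_representatives`' «matching» clause and ★ `finKappaAt_ramified_representative_eq`'s `hj` consume (`x 1 = finGammaTwo … w` by `rfl`).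
(One-place twin of ★ `endoEmbLocal_mul_endoGL_frame`.) [cite: Rogawski1990, §4.8 Case (a) p. 53; §4.9 p. 54] [cite: Flicker1998UnitaryFL, §2 Prop. 3 p. 78] -/
theorem exists_onePlace_endoGL_frame {P₂ : GL (Fin 2) (UnitaryGroup.LocalRing L v)} {u : Fin 2 → UnitaryGroup.LocalRing L v}
    (hP₂ : (a.1.val.val : Matrix (Fin 2) (Fin 2) (UnitaryGroup.LocalRing L v)) * P₂.val = P₂.val * diagonal u) :
    ∃ Q : GL (Fin 3) (w.1.adicCompletion L),
      (endoGL
          (((localNonsplitEquiv (IsCMField.complexConj L)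
              (Matrix.of fun i j : Fin 2 => if i.val + j.val + 1 = 2 then (1 : L) else 0) (IsCMField.complexConj_ne_one L) w hw a.1).val :
              GL (Fin 2) (w.1.adicCompletion L)),
            ((localNonsplitEquiv (IsCMField.complexConj L)
              (Matrix.of fun i j : Fin 1 => if i.val + j.val + 1 = 1 then (1 : L) else 0) (IsCMField.complexConj_ne_one L) w hw a.2).val :
              GL (Fin 1) (w.1.adicCompletion L))) : GL (Fin 3) (w.1.adicCompletion L)).val * Q.val =
        Q.val * diagonal ![u 0 w, finGammaTwo L v a w, u 1 w] := by
  have hc := IsCMField.complexConj_ne_one L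
  -- the `w`-components
  set gw : GL (Fin 2) (w.1.adicCompletion L) := ((localNonsplitEquiv (IsCMField.complexConj L)
      (Matrix.of fun i j : Fin 2 => if i.val + j.val + 1 = 2 then (1 : L) else 0) hc w hw a.1).val : GL (Fin 2) (w.1.adicCompletion L)) with hgw
  set hw1 : GL (Fin 1) (w.1.adicCompletion L) := ((localNonsplitEquiv (IsCMField.complexConj L)
      (Matrix.of fun i j : Fin 1 => if i.val + j.val + 1 = 1 then (1 : L) else 0) hc w hw a.2).val : GL (Fin 1) (w.1.adicCompletion L)) with hhw
  set Pw : GL (Fin 2) (w.1.adicCompletion L) := localGLPiEquiv L 2 v P₂ w with hPw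
  -- `g_w · P_w = P_w · diag(u(w))`
  have hframe : (gw : Matrix (Fin 2) (Fin 2) (w.1.adicCompletion L)) * Pw.val = Pw.val * diagonal fun i => u i w := by
    refine Matrix.ext fun i j => ?_
    have h := congr_fun (congr_fun (congr_fun hP₂ i) j) w
    rw [Matrix.mul_apply, Finset.sum_apply] at h
    simp only [Pi.mul_apply, Matrix.mul_diagonal, Pi.mul_apply] at h
    rw [Matrix.mul_apply, Matrix.mul_diagonal]
    have hg : ∀ k, (gw : Matrix (Fin 2) (Fin 2) (w.1.adicCompletion L)) i k = (a.1.val.val : Matrix (Fin 2) (Fin 2) (UnitaryGroup.LocalRing L v)) i k w :=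
      fun k => by rw [hgw]; rfl
    have hP : ∀ k l, (Pw.val : Matrix (Fin 2) (Fin 2) (w.1.adicCompletion L)) k l = (P₂.val : Matrix (Fin 2) (Fin 2) (UnitaryGroup.LocalRing L v)) k l w :=
      fun k l => by rw [hPw]; exact localGLPiEquiv_apply_apply L 2 v P₂ w k l
    simp only [hg, hP]
    convert h using 1
  -- the diagonal of `endoGL(diag(u(w)), h_w)`
  have hDu : IsUnit (diagonal fun i => u i w : Matrix (Fin 2) (Fin 2) (w.1.adicCompletion L)).det := by
    have h1 : (gw : Matrix (Fin 2) (Fin 2) (w.1.adicCompletion L)) * Pw.val * (Pw⁻¹).val = Pw.val * (diagonal fun i => u i w) * (Pw⁻¹).val := by rw [hframe]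
    rw [Matrix.mul_assoc, ← Units.val_mul, mul_inv_cancel, Units.val_one, Matrix.mul_one] at h1
    have h2 : IsUnit ((Pw.val * (diagonal fun i => u i w) * (Pw⁻¹).val).det) := by rw [← h1]; exact Matrix.isUnits_det_units gw
    rw [Matrix.det_mul, Matrix.det_mul, mul_comm (Pw.val.det), mul_assoc] at h2
    exact isUnit_of_mul_isUnit_left h2
  set Du : GL (Fin 2) (w.1.adicCompletion L) := Matrix.GeneralLinearGroup.mk'' (diagonal fun i => u i w) hDu with hDudef
  have hDuval : Du.val = diagonal fun i => u i w := rfl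
  have hgP : gw * Pw = Pw * Du := Units.ext (by rw [Units.val_mul, Units.val_mul, hDuval]; exact hframe)
  refine ⟨endoGL (Pw, 1), ?_⟩
  have hE : endoGL (gw, hw1) * endoGL (Pw, (1 : GL (Fin 1) (w.1.adicCompletion L))) = endoGL (Pw, 1) * endoGL (Du, hw1) := by
    rw [← map_mul, ← map_mul, Prod.mk_mul_mk, Prod.mk_mul_mk, hgP, mul_one, one_mul]
  have hD : (endoGL (Du, hw1) : GL (Fin 3) (w.1.adicCompletion L)).val = diagonal ![u 0 w, finGammaTwo L v a w, u 1 w] := by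
    rw [coe_endoGL_eq, hDuval]
    have h11 : (hw1 : Matrix (Fin 1) (Fin 1) (w.1.adicCompletion L)) 0 0 = finGammaTwo L v a w := by rw [hhw]; rfl
    rw [h11]
    ext i j
    fin_cases i <;> fin_cases j <;> rfl
  rw [← hD, ← Units.val_mul, ← Units.val_mul, hE]

include hw in
/-- **The one-place torus datum is regular and norm-one** when the semilocal one is: `x = (u₀(w), u(w), u₁(w))` is injective and `σ_w(xᵢ) xᵢ = 1` from `u` injective, norm-one
(★ `forall_conjLocal_mul_eq_one_of_not_exists_conj_glDiagonal` for a non-Levi `γ_H`), `u₀, u₁ ≠ u` (`G`-regularity) and `σ(u)u = 1` (★ `conjLocal_finGammaTwo_mul_finGammaTwo`).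
[cite: Rogawski1990, §4.9 p. 54; §3.6 p. 31] -/
theorem injective_and_norm_one_onePlace_of_localRing {u : Fin 2 → UnitaryGroup.LocalRing L v} (hu : Function.Injective u)
    (hu1 : ∀ i, UnitaryGroup.conjLocal L (IsCMField.complexConj L) v (u i) * u i = 1)
    (hab : u 0 ≠ finGammaTwo L v a) (hbd : finGammaTwo L v a ≠ u 1) :
    Function.Injective ![u 0 w, finGammaTwo L v a w, u 1 w] ∧
      ∀ i, galAdicCompletionMap (L := L) (IsCMField.complexConj L) hw (![u 0 w, finGammaTwo L v a w, u 1 w] i) * ![u 0 w, finGammaTwo L v a w, u 1 w] i = 1 := by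
  have hc := IsCMField.complexConj_ne_one L
  haveI : Algebra.IsQuadraticExtension ↥(maximalRealSubfield L) L := IsCMField.isQuadraticExtension L
  -- equality in `E_v` is equality at the unique place `w`
  have heq : ∀ y z : UnitaryGroup.LocalRing L v, y w = z w → y = z := fun y z h => (LocalRing.eq_iff_apply_eq (IsCMField.complexConj L) hc w hw y z).2 h
  have n01 : u 0 w ≠ finGammaTwo L v a w := fun h => hab (heq _ _ h)
  have n12 : finGammaTwo L v a w ≠ u 1 w := fun h => hbd (heq _ _ h)
  have n02 : u 0 w ≠ u 1 w := fun h => zero_ne_one (hu (heq _ _ h))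
  have hnorm : ∀ y : UnitaryGroup.LocalRing L v, UnitaryGroup.conjLocal L (IsCMField.complexConj L) v y * y = 1 →
      galAdicCompletionMap (L := L) (IsCMField.complexConj L) hw (y w) * y w = 1 := fun y hy => by
    have h := congr_fun hy w
    rw [Pi.mul_apply, conjLocal_apply_eq_galAdicCompletionMap L v w hw, Pi.one_apply] at h
    exact h
  refine ⟨fun i j hij => ?_, fun i => ?_⟩
  · fin_cases i <;> fin_cases j
    · rfl
    · exact absurd hij n01
    · exact absurd hij n02
    · exact absurd hij.symm n01
    · rfl
    · exact absurd hij n12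
    · exact absurd hij.symm n02
    · exact absurd hij.symm n12
    · rfl
  · fin_cases i
    · exact hnorm _ (hu1 0)
    · exact hnorm _ (conjLocal_finGammaTwo_mul_finGammaTwo L v a)
    · exact hnorm _ (hu1 1)

end Assembly

end Literature.NumberTheory.Rogawski1990

end
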